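import Summits.CriticalPhenomena.PercolationContinuityZ3.Theorems.PercNearOneGluingNoHeavyLowerTailSahiGridPatternKernel
import Summits.CriticalPhenomena.PercolationContinuityZ3.Theorems.PercNearOneGluingNoHeavyLowerTailSahiSlotPatternPositivity

/-!
# The without-replacement / pattern device at every order `n` and every dimension `d` — III, ORDER 3: `patternForm = sStarD`,
# `SlotPatternPos d 3 ↔ PatternPos d`, and the cell `(3,3)` (kernel, standard axioms, through prim-sahi-p1's `sStarD_three_nonneg`)

Support file of the one-cut programme (crux `NoHeavyLowerTail`, stmt-CriticalPhenomena-4575; cell `prim-masterthm`, seat P3, gen 18;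
`run/shared/lean/prim/prim-masterthm/prim-masterthm-p3/HIERARCHY.md` §26).  Sequel of `…SahiSlotPatternBridge` / `…SahiSlotPatternPositivity`.

* `diagForm_three` — the closed form of the diagonal form at order 3 (the six permutations of `Fin 3` and their cycle representatives, by `decide`):
  `D(h) = 2h₀h₁h₂(δ₀) − h₀h₁(δ₀)h₂(δ₂) − h₀h₂(δ₀)h₁(δ₁) − h₀(δ₀)h₁h₂(δ₁) + h₀(δ₀)h₁(δ₁)h₂(δ₂)`;
* `patternForm_three_eq_sum` — after relabelling two of the five terms inside the symmetrising sum (`sum_act_diag_comp`), the order-3 pattern functional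
  has exactly the shape of prim-sahi-p1's three-copy kernel `SahiGrid3.hZ` summed over permutation patterns, whence
  **`patternForm_three_setInd : patternForm d 3 (1_{U₀},1_{U₁},1_{U₂}) = SahiGridPattern.sStarD U₀ U₁ U₂`** and
  **`slotPatternPos_three_iff_patternPos : SlotPatternPos d 3 ↔ SahiGridPattern.PatternPos d`** (standard axioms): at order 3 the slot-pattern
  obligation of this lane IS the pattern obligation of cell prim-sahi — the two programmes' finite normal forms of Kahn's conjecture coincide;
* `slotPatternPos_three_three : SlotPatternPos 3 3`, `slotPatternPos_three_of_le_three` — KERNEL, STANDARD AXIOMS: through prim-sahi-p1's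
  `SahiGridPattern.sStarD_three_nonneg` (`…SahiGridPatternKernel`, 226 bilinear slice certificates checked by `decide`); the first version of this file
  re-exported `SahiGridPattern.patternPos_three`, whose closure is the superseded `native_decide` certificate of `…SahiGridThreeCheck*` — re-routed
  2026-08-22 (lit g47 axiom ledger, A47-1); P3 gen 17's `SahiThreeChain.slotPos` (`…SahiThreeChainSlotCertificate`) is an independent kernel certificate
  of the same finite fact.
HONEST LABEL: identities + a re-export; nothing new is asserted about `d ≥ 4`. [this work]
-/

noncomputable section

namespace Summit.CriticalPhenomena.PercolationContinuityZ3.Theorems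

open Finset Function Equiv Equiv.Perm
open Literature.Combinatorics.Sahi2008 Literature.Combinatorics.Sahi2008.CycleForm

namespace SahiSlot

/-! ### Order 3: the pattern functional IS prim-sahi's `sStarD` (so `SlotPatternPos d 3 ↔ PatternPos d`) -/

section Three

variable {d : ℕ}

/-- The six permutations of `Fin 3` (for the closed form of the diagonal form at order 3). [this work] -/
private theorem univ_perm_fin_three : (univ : Finset (Perm (Fin 3))) =
    {1, swap 0 1, swap 0 2, swap 1 2, swap 0 1 * swap 1 2, swap 1 2 * swap 0 1} := by decide

/-- **Order 3, closed form of the diagonal form**: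
`D(h) = 2·h₀h₁h₂(δ₀) − h₀h₁(δ₀)h₂(δ₂) − h₀h₂(δ₀)h₁(δ₁) − h₀(δ₀)h₁h₂(δ₁) + h₀(δ₀)h₁(δ₁)h₂(δ₂)` (`δ_j = diag j`; two 3-cycles, three
transpositions, the identity). [this work] -/
theorem diagForm_three (h : Fin 3 → Q d 3 → ℝ) :
    diagForm d 3 h = 2 * (h 0 (diag 0) * h 1 (diag 0) * h 2 (diag 0)) - h 0 (diag 0) * h 1 (diag 0) * h 2 (diag 2)
      - h 0 (diag 0) * h 2 (diag 0) * h 1 (diag 1) - h 0 (diag 0) * h 1 (diag 1) * h 2 (diag 1)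
      + h 0 (diag 0) * h 1 (diag 1) * h 2 (diag 2) := by
  unfold diagForm
  rw [univ_perm_fin_three]
  rw [sum_insert (by decide), sum_insert (by decide), sum_insert (by decide), sum_insert (by decide), sum_insert (by decide),
    sum_singleton]
  simp only [Fin.prod_univ_three,
    show (orbits (1 : Perm (Fin 3))).card = 3 by decide, show rep (1 : Perm (Fin 3)) 0 = 0 by decide,
    show rep (1 : Perm (Fin 3)) 1 = 1 by decide, show rep (1 : Perm (Fin 3)) 2 = 2 by decide,
    show (orbits (swap 0 1 : Perm (Fin 3))).card = 2 by decide, show rep (swap 0 1 : Perm (Fin 3)) 0 = 0 by decide,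
    show rep (swap 0 1 : Perm (Fin 3)) 1 = 0 by decide, show rep (swap 0 1 : Perm (Fin 3)) 2 = 2 by decide,
    show (orbits (swap 0 2 : Perm (Fin 3))).card = 2 by decide, show rep (swap 0 2 : Perm (Fin 3)) 0 = 0 by decide,
    show rep (swap 0 2 : Perm (Fin 3)) 1 = 1 by decide, show rep (swap 0 2 : Perm (Fin 3)) 2 = 0 by decide,
    show (orbits (swap 1 2 : Perm (Fin 3))).card = 2 by decide, show rep (swap 1 2 : Perm (Fin 3)) 0 = 0 by decide,
    show rep (swap 1 2 : Perm (Fin 3)) 1 = 1 by decide, show rep (swap 1 2 : Perm (Fin 3)) 2 = 1 by decide,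
    show (orbits (swap 0 1 * swap 1 2 : Perm (Fin 3))).card = 1 by decide, show rep (swap 0 1 * swap 1 2 : Perm (Fin 3)) 0 = 0 by decide,
    show rep (swap 0 1 * swap 1 2 : Perm (Fin 3)) 1 = 0 by decide, show rep (swap 0 1 * swap 1 2 : Perm (Fin 3)) 2 = 0 by decide,
    show (orbits (swap 1 2 * swap 0 1 : Perm (Fin 3))).card = 1 by decide, show rep (swap 1 2 * swap 0 1 : Perm (Fin 3)) 0 = 0 by decide,
    show rep (swap 1 2 * swap 0 1 : Perm (Fin 3)) 1 = 0 by decide, show rep (swap 1 2 * swap 0 1 : Perm (Fin 3)) 2 = 0 by decide]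
  norm_num
  ring

/-- Re-labelling the three diagonal points by a fixed `ρ ∈ S₃` inside the symmetrising sum (right multiplication by the constant
family `ρ`). [this work] -/
theorem sum_act_diag_comp (ρ : Perm (Fin 3)) (F : (Fin 3 → Q d 3) → ℝ) :
    ∑ τ : Fin d → Perm (Fin 3), F (fun j => act τ (diag (ρ j))) = ∑ τ : Fin d → Perm (Fin 3), F (fun j => act τ (diag j)) := by
  have h : ∀ τ : Fin d → Perm (Fin 3), (fun j => act τ (diag (ρ j))) = fun j => act (τ * fun _ => ρ) (diag j) := by
    intro τ; funext j a; simp [act, diag, Perm.mul_apply]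
  simp_rw [h]
  exact Fintype.sum_equiv (Equiv.mulRight (fun _ : Fin d => ρ)) _ _ fun τ => rfl

/-- **Order 3: `patternForm` in prim-sahi's kernel shape** — after relabelling two of the five terms,
`patternForm d 3 h = Σ_{τ ∈ S₃^d} [2h₀h₁h₂(P₀) − h₀(P₀)h₁h₂(P₁) − h₁(P₀)h₀h₂(P₁) − h₂(P₀)h₀h₁(P₁) + h₀(P₀)h₁(P₁)h₂(P₂)]`, `P_j = τ·δ_j`. [this work] -/
theorem patternForm_three_eq_sum (h : Fin 3 → Q d 3 → ℝ) :
    patternForm d 3 h = ∑ τ : Fin d → Perm (Fin 3),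
      (2 * (h 0 (act τ (diag 0)) * h 1 (act τ (diag 0)) * h 2 (act τ (diag 0)))
        - h 0 (act τ (diag 0)) * h 1 (act τ (diag 1)) * h 2 (act τ (diag 1))
        - h 1 (act τ (diag 0)) * h 0 (act τ (diag 1)) * h 2 (act τ (diag 1))
        - h 2 (act τ (diag 0)) * h 0 (act τ (diag 1)) * h 1 (act τ (diag 1))
        + h 0 (act τ (diag 0)) * h 1 (act τ (diag 1)) * h 2 (act τ (diag 2))) := by
  unfold patternForm
  simp_rw [diagForm_three]
  simp only [comp_apply, sum_add_distrib, sum_sub_distrib]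
  -- the two terms whose point labels differ from the kernel shape
  have e1 : ∑ τ : Fin d → Perm (Fin 3), h 0 (act τ (diag 0)) * h 1 (act τ (diag 0)) * h 2 (act τ (diag 2)) =
      ∑ τ : Fin d → Perm (Fin 3), h 2 (act τ (diag 0)) * h 0 (act τ (diag 1)) * h 1 (act τ (diag 1)) := by
    have := sum_act_diag_comp (d := d) (swap 0 1 * swap 1 2) (fun P => h 0 (P 0) * h 1 (P 0) * h 2 (P 2))
    rw [← this]
    refine sum_congr rfl fun τ _ => ?_
    simp only [show (swap 0 1 * swap 1 2 : Perm (Fin 3)) 0 = 1 by decide, show (swap 0 1 * swap 1 2 : Perm (Fin 3)) 2 = 0 by decide]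
    ring
  have e2 : ∑ τ : Fin d → Perm (Fin 3), h 0 (act τ (diag 0)) * h 2 (act τ (diag 0)) * h 1 (act τ (diag 1)) =
      ∑ τ : Fin d → Perm (Fin 3), h 1 (act τ (diag 0)) * h 0 (act τ (diag 1)) * h 2 (act τ (diag 1)) := by
    have := sum_act_diag_comp (d := d) (swap 0 1) (fun P => h 0 (P 0) * h 2 (P 0) * h 1 (P 1))
    rw [← this]
    refine sum_congr rfl fun τ _ => ?_
    simp only [swap_apply_left, swap_apply_right]
    ring
  rw [e1, e2]
  ring

/-- The real indicator is the cast of prim-sahi's integer indicator. [this work] -/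
theorem setInd_eq_cast_ind {Y : Type*} [DecidableEq Y] (S : Finset Y) (y : Y) : setInd S y = (SahiGrid3.ind S y : ℝ) := by
  unfold setInd SahiGrid3.ind
  split_ifs <;> simp

/-- **At order 3 the pattern functional is prim-sahi's `sStarD`**: `patternForm d 3 (1_{U₀},1_{U₁},1_{U₂}) = sStarD U₀ U₁ U₂`. [this work] -/
theorem patternForm_three_setInd (U : Fin 3 → Finset (Q d 3)) :
    patternForm d 3 (fun i => setInd (U i)) = (SahiGridPattern.sStarD (U 0) (U 1) (U 2) : ℝ) := by
  rw [patternForm_three_eq_sum]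
  unfold SahiGridPattern.sStarD
  push_cast
  refine sum_congr rfl fun τ _ => ?_
  unfold SahiGrid3.hZ
  simp only [setInd_eq_cast_ind]
  push_cast
  rfl

/-- **`SlotPatternPos d 3 ↔ PatternPos d`** (prim-sahi's order-3 obligation): the two finite statements coincide. [this work] -/
theorem slotPatternPos_three_iff_patternPos : SlotPatternPos d 3 ↔ SahiGridPattern.PatternPos d := by
  constructor
  · intro h A B C hA hB hC
    have h1 := h ![A, B, C] (fun i => by fin_cases i <;> assumption)
    rw [patternForm_three_setInd] at h1
    exact_mod_cast h1
  · intro h U hU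
    rw [patternForm_three_setInd]
    exact_mod_cast h (U 0) (U 1) (U 2) (hU 0) (hU 1) (hU 2)

/-- **`SlotPatternPos 3 3`** — Sahi's `C₃` in dimension three, coefficientwise, in the slot-pattern normal form (kernel, standard axioms: prim-sahi-p1's
`SahiGridPattern.sStarD_three_nonneg`; P3 gen 17's `SahiThreeChain.slotPos` is an independent certificate of the same finite fact). [this work] -/
theorem slotPatternPos_three_three : SlotPatternPos 3 3 :=
  slotPatternPos_three_iff_patternPos.2 fun A B C => SahiGridPattern.sStarD_three_nonneg A B C

/-- `SlotPatternPos d 3` for every `d ≤ 3` (kernel, standard axioms, for the same reason). [this work] -/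
theorem slotPatternPos_three_of_le_three (hd : d ≤ 3) : SlotPatternPos d 3 :=
  slotPatternPos_three_iff_patternPos.2 (SahiGridPattern.patternPos_of_le hd fun A B C => SahiGridPattern.sStarD_three_nonneg A B C)

end Three

end SahiSlot

end Summit.CriticalPhenomena.PercolationContinuityZ3.Theorems
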